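import Mathlib
import Summits.RiemannHypothesis.RiemannHypothesis.Theorems.HandoffInertiaCount
import HarnessLib

/-!
# HANDOFF — FROM COUNTING FUNCTIONS TO SORTED EIGENVALUES: Weyl monotonicity and perturbation, Cauchy interlacing and the
# Rayleigh bottom in the λ_k form (cell rh-explicit, TRACK «HANDOFF», seat theory-2 gen12; FILE XII-z′; finite-dimensional folklore)

HONEST FRAMING. Nothing in this file bears on the truth of RH; it is elementary real linear algebra. XII-y (`HandoffInertiaCount`)
and XII-z (`HandoffWeylCounting`) state everything for the COUNTING FUNCTION `c ↦ #{i | λᵢ < c}`; the cell's pens (LADDER, EDGEWALL,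
STRUCTURE, MARGIN-LAW) write the same facts for SORTED eigenvalues `λ_k`. This file is the dictionary, on Mathlib's sorted list
`Matrix.IsHermitian.eigenvalues₀ : Fin (card n) → ℝ` (ANTITONE: `λ↓_0 ≥ λ↓_1 ≥ … ≥ λ↓_{N−1}`, `eigenvalues₀_antitone`; `hA.eigenvalues i`
is `eigenvalues₀` re-indexed by `n`):
§1 COMBINATORICS: for antitone `a, b : Fin N → ℝ`, «`#{a < c} ≤ #{b < c + ε} + m` for every `c`» ⟹ «`b_{k+m} ≤ a_k + ε` for every
   `k`» (`antitone_apply_add_le`; the two counting lemmas `card_sub_le_card_lt_of_antitone`, `card_lt_le_of_antitone`).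
§2 TRANSPORT `#{i : n | λᵢ < c} = #{j : Fin N | λ↓_j < c}` and the MASTER TRANSFER `eigenvalues₀_le_add_of_le_on_ker`: «`x·Bx ≤ x·Ax + ε‖x‖²`
   off `m` vectors ⟹ `λ↓_{k+m}(B) ≤ λ↓_k(A) + ε`» (XII-z's counting argument, re-derived from XII-y: this file imports only BUILT modules).
§3 THE CLASSICAL STATEMENTS: WEYL MONOTONICITY `B ≤ A ⟹ λ↓_k(B) ≤ λ↓_k(A)` (`eigenvalues₀_mono`); WEYL PERTURBATION
   `|x·(B−A)x| ≤ ε‖x‖² ⟹ |λ↓_k(B) − λ↓_k(A)| ≤ ε` (`eigenvalues₀_le_add_of_forall`, `abs_eigenvalues₀_sub_le`) — every sorted eigenvalue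
   of a section is 1-Lipschitz in the form, the stability statement behind comparing sections at neighbouring N / meshes / bandwidths;
   CODIMENSION-m `B ≤ A off m vectors ⟹ λ↓_{k+m}(B) ≤ λ↓_k(A)` (`eigenvalues₀_add_le_of_le_on_ker`); CAUCHY INTERLACING for
   `A ∓ t·v vᵀ` (`eigenvalues₀_interlace_sub` / `_add`: `λ↓_{k+1}(A) ≤ λ↓_k(A − t v vᵀ) ≤ λ↓_k(A)` and the mirror).
§4 RAYLEIGH BOTTOM `λ↓_{N−1}(A)·‖x‖² ≤ x·Ax` (`eigenvalues₀_last_mul_le`) — «a section's bottom eigenvalue is below every Rayleigh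
   quotient», the sentence behind «finite sections give UPPER bounds» (HANDOFF-STATEMENT §H.3) for matrices.
What is NOT here: anything infinite-dimensional (the cell's λ_min(S; t; σ) objects live in `HandoffSemilocalEnergy`), strictness, the
top Rayleigh bound, anything about ζ. No `def`s. References (folklore): Cauchy 1829; Weyl, Math. Ann. 71 (1912); Courant, Math. Z. 7
(1920); Horn–Johnson, Matrix Analysis, Thms 4.2.2, 4.3.1, 4.3.4, Cor. 4.3.15. Companions: XII-y `HandoffInertiaCount` (imported), XII-z `HandoffWeylCounting` (the counting-function form; not imported — its olean is in the farm's build backlog tonight, so the two steps it would supply are re-derived inline).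
-/

set_option linter.dupNamespace false  -- the mandated namespace repeats `RiemannHypothesis`

open Matrix Finset Module
open Summit.RiemannHypothesis.RiemannHypothesis.Theorems.HandoffInertiaCount

namespace Summit.RiemannHypothesis.RiemannHypothesis.Theorems.HandoffEigenvalueOrder

/-! ## §1 Order statistics from counting functions (pure combinatorics on antitone sequences) -/

section Combinatorics
variable {N : ℕ}

/-- If `a` is antitone on `Fin N` and `a k < c`, then at least `N − k` indices have `a i < c` (all `i ≥ k`). [folklore] -/
theorem card_sub_le_card_lt_of_antitone (a : Fin N → ℝ) (ha : Antitone a) {k : Fin N} {c : ℝ} (hk : a k < c) :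
    N - k ≤ Fintype.card {i // a i < c} := by
  classical
  rw [Fintype.card_subtype, ← Fin.card_Ici]
  exact Finset.card_le_card fun i hi ↦ Finset.mem_filter.mpr ⟨Finset.mem_univ _, (ha (Finset.mem_Ici.mp hi)).trans_lt hk⟩

/-- If `b` is antitone on `Fin N` and `c ≤ b j`, then at most `N − 1 − j` indices have `b i < c` (only `i > j`). [folklore] -/
theorem card_lt_le_of_antitone (b : Fin N → ℝ) (hb : Antitone b) {j : Fin N} {c : ℝ} (hj : c ≤ b j) :
    Fintype.card {i // b i < c} ≤ N - 1 - j := by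
  classical
  rw [Fintype.card_subtype, ← Fin.card_Ioi]
  refine Finset.card_le_card fun i hi ↦ Finset.mem_Ioi.mpr ?_
  by_contra h
  exact absurd ((hj.trans (hb (not_lt.mp h))).trans_lt (Finset.mem_filter.mp hi).2) (lt_irrefl _)

/-- **ORDER STATISTICS FROM COUNTS.** For antitone (= sorted in DECREASING order) `a, b : Fin N → ℝ`: if for every level `c` the
number of `a`-values below `c` is at most the number of `b`-values below `c + ε`, plus `m`, then the `(k+m)`-th largest `b` is at most
the `k`-th largest `a` plus `ε`. (`ε = 0, m = 0`: pointwise order; `m = 1`: interlacing shift.) [folklore] -/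
theorem antitone_apply_add_le (a b : Fin N → ℝ) (ha : Antitone a) (hb : Antitone b) {ε : ℝ} {m : ℕ}
    (h : ∀ c : ℝ, Fintype.card {i // a i < c} ≤ Fintype.card {i // b i < c + ε} + m) (k : Fin N) (j : Fin N)
    (hj : (j : ℕ) = k + m) : b j ≤ a k + ε := by
  by_contra hlt
  push Not at hlt
  have h1 := card_sub_le_card_lt_of_antitone a ha (k := k) (c := b j - ε) (by linarith)
  have h2 := card_lt_le_of_antitone b hb (j := j) (c := b j - ε + ε) (by linarith)
  have h3 := h (b j - ε)
  have hk := k.2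
  have hj2 := j.2
  omega

end Combinatorics

/-! ## §2 Transport: Mathlib's sorted eigenvalues `eigenvalues₀` (antitone on `Fin (card n)`) vs `eigenvalues` (indexed by `n`) -/

variable {n : Type*} [Fintype n] [DecidableEq n]

/-- The count below a level is the same for `hA.eigenvalues` and the sorted list `hA.eigenvalues₀`. [folklore] -/
theorem card_eigenvalues_lt_eq_card_eigenvalues₀_lt {A : Matrix n n ℝ} (hA : A.IsHermitian) (c : ℝ) :
    Fintype.card {i // hA.eigenvalues i < c} = Fintype.card {j // hA.eigenvalues₀ j < c} := by
  refine Fintype.card_congr (Equiv.subtypeEquiv (Fintype.equivOfCardEq (Fintype.card_fin _)).symm fun i ↦ ?_)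
  rfl

/-- The count of eigenvalues below a level `c` is the negative index of the shifted form `x ↦ x·(A − c·1)x` (XII-z's
`card_eigenvalues_lt_eq_sigNeg`, re-derived here from XII-y so that this file needs only BUILT imports). [folklore] -/
theorem card_eigenvalues₀_lt_eq_sigNeg {A : Matrix n n ℝ} (hA : A.IsHermitian) (c : ℝ) :
    Fintype.card {j // hA.eigenvalues₀ j < c} = sigNeg (A - c • (1 : Matrix n n ℝ)).toQuadraticForm' := by
  rw [← card_eigenvalues_lt_eq_card_eigenvalues₀_lt,
    sigNeg_eq_card_of_orthonormal_eigenvectors (A - c • (1 : Matrix n n ℝ)) (fun i ↦ ⇑(hA.eigenvectorBasis i))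
    (fun i ↦ hA.eigenvalues i - c) (eigenvectorBasis_dotProduct hA) fun i ↦ by
      rw [sub_mulVec, smul_mulVec, one_mulVec, hA.mulVec_eigenvectorBasis i, sub_smul]]
  exact Fintype.card_congr (Equiv.subtypeEquivRight fun i ↦ sub_neg.symm)

/-- **THE MASTER TRANSFER.** If the forms compare as `x·Bx ≤ x·Ax + ε‖x‖²` off the `m` rows of `U`, then the sorted eigenvalues
satisfy `λ↓_{k+m}(B) ≤ λ↓_k(A) + ε`. Proof: a negative-definite subspace `V` for `A − c·1` meets `ker U` in dimension
`≥ dim V − m`, and there `B − (c+ε)·1 ≤ A − c·1 < 0`; so `#{λ(A) < c} ≤ #{λ(B) < c + ε} + m` for every `c` (the counting form,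
XII-z), and §1 converts counts to order statistics. [folklore: Weyl 1912 / Courant–Fischer] -/
theorem eigenvalues₀_le_add_of_le_on_ker {A B : Matrix n n ℝ} (hA : A.IsHermitian) (hB : B.IsHermitian) {m : ℕ}
    (U : Matrix (Fin m) n ℝ) {ε : ℝ} (h : ∀ x, U *ᵥ x = 0 → x ⬝ᵥ B *ᵥ x ≤ x ⬝ᵥ A *ᵥ x + ε * (x ⬝ᵥ x))
    (k j : Fin (Fintype.card n)) (hj : (j : ℕ) = k + m) : hB.eigenvalues₀ j ≤ hA.eigenvalues₀ k + ε := by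
  refine antitone_apply_add_le _ _ hA.eigenvalues₀_antitone hB.eigenvalues₀_antitone (fun c ↦ ?_) k j hj
  rw [card_eigenvalues₀_lt_eq_sigNeg hA, card_eigenvalues₀_lt_eq_sigNeg hB]
  -- the subspace-intersection count: sigNeg(A − c1) + dim ker U ≤ sigNeg(B − (c+ε)1) + n, and n ≤ dim ker U + m
  set A' := A - c • (1 : Matrix n n ℝ)
  set B' := B - (c + ε) • (1 : Matrix n n ℝ)
  have hW : ∀ x ∈ LinearMap.ker U.mulVecLin, x ⬝ᵥ B' *ᵥ x ≤ x ⬝ᵥ A' *ᵥ x := by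
    intro x hx
    have hx' : U *ᵥ x = 0 := by simpa [LinearMap.mem_ker] using hx
    simp only [A', B', sub_mulVec, smul_mulVec, one_mulVec, dotProduct_sub, dotProduct_smul, smul_eq_mul]
    linarith [h x hx']
  obtain ⟨V, hVr, hV⟩ := exists_finrank_eq_sigNeg_and_negDef A'.toQuadraticForm'
  have hdim : finrank ℝ V + finrank ℝ (LinearMap.ker U.mulVecLin) ≤
      finrank ℝ ↥(V ⊓ LinearMap.ker U.mulVecLin) + Fintype.card n := by
    have h1 := Submodule.finrank_sup_add_finrank_inf_eq V (LinearMap.ker U.mulVecLin)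
    have h2 : finrank ℝ ↥(V ⊔ LinearMap.ker U.mulVecLin) ≤ Fintype.card n := by
      simpa [finrank_fintype_fun_eq_card] using Submodule.finrank_le (V ⊔ LinearMap.ker U.mulVecLin)
    omega
  have hVW : ((-B'.toQuadraticForm').restrict (V ⊓ LinearMap.ker U.mulVecLin)).PosDef := by
    intro x hx
    have hx0 : (x : n → ℝ) ≠ 0 := fun h0 ↦ hx ((Submodule.coe_eq_zero).mp h0)
    have hAx : 0 < (-A'.toQuadraticForm') x := by
      have h0 := hV ⟨x, x.2.1⟩ (fun h0 ↦ hx0 (by simpa using congrArg Subtype.val h0))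
      simpa [QuadraticMap.restrict_apply] using h0
    rw [QuadraticMap.neg_apply, toQuadraticForm'_apply, neg_pos] at hAx
    rw [QuadraticMap.restrict_apply, QuadraticMap.neg_apply, toQuadraticForm'_apply, neg_pos]
    exact (hW x x.2.2).trans_lt hAx
  have h3 := le_sigNeg_of_negDef B'.toQuadraticForm' hVW
  have h4 := card_le_finrank_ker_add U
  omega

/-! ## §3 The classical statements, λ_k form (Mathlib's `eigenvalues₀` is sorted DECREASINGLY: `λ↓_0 ≥ λ↓_1 ≥ …`) -/

/-- **WEYL MONOTONICITY.** `x·Bx ≤ x·Ax` for all `x` ⟹ `λ↓_k(B) ≤ λ↓_k(A)` for every `k`. [folklore: Weyl 1912] -/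
theorem eigenvalues₀_mono {A B : Matrix n n ℝ} (hA : A.IsHermitian) (hB : B.IsHermitian)
    (h : ∀ x, x ⬝ᵥ B *ᵥ x ≤ x ⬝ᵥ A *ᵥ x) (k : Fin (Fintype.card n)) : hB.eigenvalues₀ k ≤ hA.eigenvalues₀ k := by
  simpa using eigenvalues₀_le_add_of_le_on_ker hA hB (m := 0) (fun _ _ ↦ (0 : ℝ)) (ε := 0)
    (fun x _ ↦ by simpa using h x) k k (by simp)

/-- **WEYL'S PERTURBATION THEOREM** (one-sided form): `x·Bx ≤ x·Ax + ε‖x‖²` for all `x` ⟹ `λ↓_k(B) ≤ λ↓_k(A) + ε`; with the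
symmetric hypothesis, `|λ↓_k(A) − λ↓_k(B)| ≤ ε` — every sorted eigenvalue is 1-Lipschitz in the form (operator norm). [folklore] -/
theorem eigenvalues₀_le_add_of_forall {A B : Matrix n n ℝ} (hA : A.IsHermitian) (hB : B.IsHermitian) {ε : ℝ}
    (h : ∀ x, x ⬝ᵥ B *ᵥ x ≤ x ⬝ᵥ A *ᵥ x + ε * (x ⬝ᵥ x)) (k : Fin (Fintype.card n)) :
    hB.eigenvalues₀ k ≤ hA.eigenvalues₀ k + ε :=
  eigenvalues₀_le_add_of_le_on_ker hA hB (m := 0) (fun _ _ ↦ (0 : ℝ)) (fun x _ ↦ h x) k k (by simp)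

/-- Two-sided Weyl perturbation: `|x·(B − A)x| ≤ ε‖x‖²` for all `x` ⟹ `|λ↓_k(B) − λ↓_k(A)| ≤ ε`. [folklore] -/
theorem abs_eigenvalues₀_sub_le {A B : Matrix n n ℝ} (hA : A.IsHermitian) (hB : B.IsHermitian) {ε : ℝ}
    (h : ∀ x, |x ⬝ᵥ B *ᵥ x - x ⬝ᵥ A *ᵥ x| ≤ ε * (x ⬝ᵥ x)) (k : Fin (Fintype.card n)) :
    |hB.eigenvalues₀ k - hA.eigenvalues₀ k| ≤ ε := by
  rw [abs_sub_le_iff]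
  constructor
  · linarith [eigenvalues₀_le_add_of_forall hA hB (ε := ε) (fun x ↦ by linarith [(abs_le.mp (h x)).2]) k]
  · linarith [eigenvalues₀_le_add_of_forall hB hA (ε := ε) (fun x ↦ by linarith [(abs_le.mp (h x)).1]) k]

/-- **CODIMENSION-m COMPARISON.** `x·Bx ≤ x·Ax` off `m` vectors ⟹ `λ↓_{k+m}(B) ≤ λ↓_k(A)` (a perturbation that raises the form on
at most `m` directions lifts at most `m` sorted eigenvalues past any eigenvalue of `A`). [folklore: Courant–Fischer] -/
theorem eigenvalues₀_add_le_of_le_on_ker {A B : Matrix n n ℝ} (hA : A.IsHermitian) (hB : B.IsHermitian) {m : ℕ}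
    (U : Matrix (Fin m) n ℝ) (h : ∀ x, U *ᵥ x = 0 → x ⬝ᵥ B *ᵥ x ≤ x ⬝ᵥ A *ᵥ x) (k j : Fin (Fintype.card n))
    (hj : (j : ℕ) = k + m) : hB.eigenvalues₀ j ≤ hA.eigenvalues₀ k := by
  simpa using eigenvalues₀_le_add_of_le_on_ker hA hB U (ε := 0) (fun x hx ↦ by simpa using h x hx) k j hj

/-- **CAUCHY INTERLACING, λ_k form** (lowering rank-one update `P = A − t·v vᵀ`, `t ≥ 0`): `λ↓_k(P) ≤ λ↓_k(A)` and
`λ↓_{k+1}(A) ≤ λ↓_k(P)` — each sorted eigenvalue moves down, but not below the next one of `A`. [folklore: Cauchy 1829] -/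
theorem eigenvalues₀_interlace_sub {A : Matrix n n ℝ} (hA : A.IsHermitian) (v : n → ℝ) {t : ℝ} (ht : 0 ≤ t)
    (hP : (A - t • vecMulVec v v).IsHermitian) (k : Fin (Fintype.card n)) :
    hP.eigenvalues₀ k ≤ hA.eigenvalues₀ k ∧ ∀ j : Fin (Fintype.card n), (j : ℕ) = k + 1 → hA.eigenvalues₀ j ≤ hP.eigenvalues₀ k := by
  refine ⟨eigenvalues₀_mono hA hP (fun x ↦ ?_) k, fun j hj ↦ eigenvalues₀_add_le_of_le_on_ker hP hA (fun _ : Fin 1 ↦ v)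
    (fun x hx ↦ ?_) k j hj⟩
  · rw [sub_mulVec, dotProduct_sub, smul_mulVec, Matrix.vecMulVec_mulVec, op_smul_eq_smul, dotProduct_smul, dotProduct_smul,
      sub_le_self_iff, smul_eq_mul, smul_eq_mul, dotProduct_comm x v]
    exact mul_nonneg ht (mul_self_nonneg _)
  · have hv : v ⬝ᵥ x = 0 := by simpa [Matrix.mulVec, dotProduct, funext_iff] using hx
    rw [sub_mulVec, dotProduct_sub, smul_mulVec, Matrix.vecMulVec_mulVec, op_smul_eq_smul, hv]
    simp

/-- The RAISING update `P = A + t·v vᵀ` (`t ≥ 0`): `λ↓_k(A) ≤ λ↓_k(P)` and `λ↓_{k+1}(P) ≤ λ↓_k(A)`. [folklore] -/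
theorem eigenvalues₀_interlace_add {A : Matrix n n ℝ} (hA : A.IsHermitian) (v : n → ℝ) {t : ℝ} (ht : 0 ≤ t)
    (hP : (A + t • vecMulVec v v).IsHermitian) (k : Fin (Fintype.card n)) :
    hA.eigenvalues₀ k ≤ hP.eigenvalues₀ k ∧ ∀ j : Fin (Fintype.card n), (j : ℕ) = k + 1 → hP.eigenvalues₀ j ≤ hA.eigenvalues₀ k := by
  refine ⟨eigenvalues₀_mono hP hA (fun x ↦ ?_) k, fun j hj ↦ eigenvalues₀_add_le_of_le_on_ker hA hP (fun _ : Fin 1 ↦ v)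
    (fun x hx ↦ ?_) k j hj⟩
  · rw [add_mulVec, dotProduct_add, smul_mulVec, Matrix.vecMulVec_mulVec, op_smul_eq_smul, dotProduct_smul, dotProduct_smul,
      le_add_iff_nonneg_right, smul_eq_mul, smul_eq_mul, dotProduct_comm x v]
    exact mul_nonneg ht (mul_self_nonneg _)
  · have hv : v ⬝ᵥ x = 0 := by simpa [Matrix.mulVec, dotProduct, funext_iff] using hx
    rw [add_mulVec, dotProduct_add, smul_mulVec, Matrix.vecMulVec_mulVec, op_smul_eq_smul, hv]
    simp

/-! ## §4 Rayleigh: the smallest eigenvalue is below every Rayleigh quotient -/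

/-- **RAYLEIGH, BOTTOM.** For `x ≠ 0`, the smallest sorted eigenvalue satisfies `λ↓_{N−1}(A)·(x·x) ≤ x·Ax`. (If `x·Ax < c‖x‖²`
then `A − c·1` has a negative vector, so some eigenvalue is `< c`; let `c ↓ x·Ax/‖x‖²`.) [folklore] -/
theorem eigenvalues₀_last_mul_le {A : Matrix n n ℝ} (hA : A.IsHermitian) (x : n → ℝ) (hx : x ≠ 0) (j : Fin (Fintype.card n))
    (hj : (j : ℕ) = Fintype.card n - 1) : hA.eigenvalues₀ j * (x ⬝ᵥ x) ≤ x ⬝ᵥ A *ᵥ x := by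
  have hxx : 0 < x ⬝ᵥ x := by simpa using dotProduct_star_self_pos_iff.mpr hx
  rw [← le_div_iff₀ hxx]
  refine le_of_forall_gt_imp_ge_of_dense fun c hc ↦ ?_
  have hneg : x ⬝ᵥ (A - c • (1 : Matrix n n ℝ)) *ᵥ x < 0 := by
    rw [sub_mulVec, smul_mulVec, one_mulVec, dotProduct_sub, dotProduct_smul, smul_eq_mul, sub_neg, ← div_lt_iff₀ hxx]
    exact hc
  have h1 : 1 ≤ Fintype.card {i // hA.eigenvalues₀ i < c} := by
    rw [card_eigenvalues₀_lt_eq_sigNeg hA c]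
    exact one_le_sigNeg_of_neg _ hneg
  obtain ⟨⟨i, hi⟩⟩ := Fintype.card_pos_iff.mp h1
  exact ((hA.eigenvalues₀_antitone (Fin.le_iff_val_le_val.mpr (by have := i.2; omega))).trans hi.le)

end Summit.RiemannHypothesis.RiemannHypothesis.Theorems.HandoffEigenvalueOrder
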